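import Literature.AnabelianGeometry.SemiGraphs.ProSigmaFreeFactorMalnormal
import Literature.AnabelianGeometry.SemiGraphs.ProSigmaCompletionInjective
import Literature.AnabelianGeometry.AbsoluteAnabelian.ProfiniteTerminology
import HarnessLib

/-!
# Free-factor malnormality in pro-`Σ` completions, IV: disjoint sub-bases, intersections,
# commensurable terminality

Companion to `ProSigmaFreeFactorMalnormal.lean` (Ribes–Zalesskii, *Profinite Groups*, Thm. 9.1.12
[cite: RibesZalesskii2010, Thm. 9.1.12], free pro-`Σ` groups).  Same setting: `Γ` free with basis
`b : β → Γ`, `ι : Γ → P` a pro-`Σ` completion (`P` profinite), and for `S ⊆ β` the closed subgroup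
`A_S := ((Subgroup.closure (b '' S)).map ι).topologicalClosure`.  The elementary consequences used to
instantiate [CombGC] Prop. 1.2 / 1.5 at genuine multi-vertex pointed stable curves:

* `freeFactor_inf_conj_eq_bot_of_disjoint` — for DISJOINT `S`, `T`: `A_S ∩ x A_T x⁻¹ = 1` for EVERY
  `x` (the retraction onto `A_T` kills `A_S` and fixes `A_T`);
* `freeFactor_inf_eq` — `A_S ∩ A_T = A_{S ∩ T}` (the retractions commute: `ρ̂_S ∘ ρ̂_T = ρ̂_{S ∩ T}`);
* `infinite_freeFactor` — `A_S` is infinite for `S ≠ ∅` (`Σ` containing a prime);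
* `isCommensurablyTerminal_of_inf_conj_eq_bot` — an infinite malnormal subgroup is commensurably
  terminal; hence `freeFactor_isCommensurablyTerminal`: `C_P(A_S) = A_S` ([CombGC] Prop. 1.2 (ii)
  shape), and `commensurator_smul_eq_smul` for its conjugates;
* `not_isOpen_inf_subgroupOf_of_inf_eq_bot` — if an infinite closed `B ≤ A` meets `X` trivially,
  then `A ∩ X` is not open in `A` ([CombGC] Prop. 1.2 (i) shape).

Theorems only; classical profinite group theory; nothing here takes a side on [IUTchIII] Cor. 3.12.
-/

namespace Literature.AnabelianGeometry.SemiGraphs.SemiGraphOfAnabelioids.IsProSigmaCompletion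

open Literature.AnabelianGeometry.Anabelioids Topology
open scoped Pointwise

variable {Sigma : Set ℕ} {Γ : Type*} [Group Γ] {P : Type*} [Group P] [TopologicalSpace P]
  [IsTopologicalGroup P] [CompactSpace P] [TotallyDisconnectedSpace P] {ι : Γ →* P}

/-! ### Disjoint sub-bases -/

/-- **Disjoint sub-bases give everywhere-disjoint conjugates.**  For `S`, `T ⊆ β` disjoint and EVERY
`x ∈ P`: `A_S ∩ x A_T x⁻¹ = 1`.  (The continuous retraction `ρ̂_T` onto `A_T` — `b_t ↦ b_t` for
`t ∈ T`, `b_j ↦ 1` otherwise — kills `b(S)`, hence `A_S`; for `y = x z x⁻¹ ∈ A_S` with `z ∈ A_T` this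
reads `ρ̂_T(x) z ρ̂_T(x)⁻¹ = 1`, so `z = 1`.) [cite: RibesZalesskii2010, Thm. 9.1.12] -/
theorem freeFactor_inf_conj_eq_bot_of_disjoint [T2Space P] {β : Type*} (b : FreeGroupBasis β Γ)
    (S T : Set β) (hST : Disjoint S T) (hι : IsProSigmaCompletion Sigma ι) (x : P) :
    ((Subgroup.closure (b '' S)).map ι).topologicalClosure ⊓
      ConjAct.toConjAct x • ((Subgroup.closure (b '' T)).map ι).topologicalClosure = ⊥ := by
  classical
  let ρ : Γ →* Γ := b.lift fun j => if j ∈ T then b j else 1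
  have hρ : ∀ j, ρ (b j) = if j ∈ T then b j else 1 := fun j => b.lift_apply_basis _ j
  obtain ⟨ρh, hρhc, hρhι'⟩ := exists_continuous_extend_profinite hι hι.index_open (ι.comp ρ)
  have hρhι : ∀ γ, ρh (ι γ) = ι (ρ γ) := fun γ => hρhι' γ
  obtain ⟨hρhA, -⟩ := freeFactor_retract_apply b T ρ hρ hι _ rfl ρh hρhc hρhι
  -- `ρ̂_T` kills `A_S`
  have hkill : ∀ y ∈ ((Subgroup.closure (b '' S)).map ι).topologicalClosure, ρh y = 1 := by
    have hle : ((Subgroup.closure (b '' S)).map ι).topologicalClosure ≤ ρh.ker := by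
      refine Subgroup.topologicalClosure_minimal _ ?_
        ((isClosed_singleton (x := (1 : P))).preimage hρhc)
      rintro _ ⟨d, hd, rfl⟩
      rw [MonoidHom.mem_ker, hρhι]
      have hρS : Set.EqOn ρ (1 : Γ →* Γ) (b '' S) := by
        rintro _ ⟨j, hj, rfl⟩
        rw [hρ j, if_neg (Disjoint.notMem_of_mem_left hST hj)]
        rfl
      rw [MonoidHom.eqOn_closure hρS hd, MonoidHom.one_apply, map_one]
    exact fun y hy => hle hy
  rw [eq_bot_iff]
  rintro y ⟨hyS, hyT⟩
  obtain ⟨z, hz, rfl⟩ := (Subgroup.mem_smul_pointwise_iff_exists _ _ _).mp hyT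
  have h1 := hkill _ hyS
  rw [ConjAct.toConjAct_smul, map_mul, map_mul, map_inv, hρhA z hz, mul_inv_eq_one, mul_eq_left]
    at h1
  rw [Subgroup.mem_bot, ConjAct.toConjAct_smul, h1, mul_one, mul_inv_cancel]

/-- **Intersections of sub-basis closures**: `A_S ∩ A_T = A_{S ∩ T}` (the retractions satisfy
`ρ̂_S ∘ ρ̂_T = ρ̂_{S ∩ T}`, so an element fixed by both lies in the image `A_{S ∩ T}` of the composite).
[cite: RibesZalesskii2010, Thm. 9.1.12] -/
theorem freeFactor_inf_eq [T2Space P] {β : Type*} (b : FreeGroupBasis β Γ) (S T : Set β)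
    (hι : IsProSigmaCompletion Sigma ι) :
    ((Subgroup.closure (b '' S)).map ι).topologicalClosure ⊓
      ((Subgroup.closure (b '' T)).map ι).topologicalClosure =
        ((Subgroup.closure (b '' (S ∩ T))).map ι).topologicalClosure := by
  classical
  -- the three retractions
  let ρS : Γ →* Γ := b.lift fun j => if j ∈ S then b j else 1
  have hρS : ∀ j, ρS (b j) = if j ∈ S then b j else 1 := fun j => b.lift_apply_basis _ j
  let ρT : Γ →* Γ := b.lift fun j => if j ∈ T then b j else 1
  have hρT : ∀ j, ρT (b j) = if j ∈ T then b j else 1 := fun j => b.lift_apply_basis _ j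
  let ρST : Γ →* Γ := b.lift fun j => if j ∈ S ∩ T then b j else 1
  have hρST : ∀ j, ρST (b j) = if j ∈ S ∩ T then b j else 1 := fun j => b.lift_apply_basis _ j
  obtain ⟨fS, hfSc, hfSι'⟩ := exists_continuous_extend_profinite hι hι.index_open (ι.comp ρS)
  obtain ⟨fT, hfTc, hfTι'⟩ := exists_continuous_extend_profinite hι hι.index_open (ι.comp ρT)
  obtain ⟨fST, hfSTc, hfSTι'⟩ := exists_continuous_extend_profinite hι hι.index_open (ι.comp ρST)
  have hfSι : ∀ γ, fS (ι γ) = ι (ρS γ) := fun γ => hfSι' γ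
  have hfTι : ∀ γ, fT (ι γ) = ι (ρT γ) := fun γ => hfTι' γ
  have hfSTι : ∀ γ, fST (ι γ) = ι (ρST γ) := fun γ => hfSTι' γ
  obtain ⟨hfSA, -⟩ := freeFactor_retract_apply b S ρS hρS hι _ rfl fS hfSc hfSι
  obtain ⟨hfTA, -⟩ := freeFactor_retract_apply b T ρT hρT hι _ rfl fT hfTc hfTι
  obtain ⟨-, hfSTmem⟩ := freeFactor_retract_apply b (S ∩ T) ρST hρST hι _ rfl fST hfSTc hfSTι
  -- `ρ_S ∘ ρ_T = ρ_{S ∩ T}`, hence `ρ̂_S ∘ ρ̂_T = ρ̂_{S ∩ T}`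
  have hρρ : ρS.comp ρT = ρST := by
    refine b.ext_hom _ _ fun j => ?_
    rw [MonoidHom.comp_apply, hρT j, hρST j]
    by_cases hjT : j ∈ T
    · rw [if_pos hjT, hρS j]
      by_cases hjS : j ∈ S
      · rw [if_pos hjS, if_pos ⟨hjS, hjT⟩]
      · rw [if_neg hjS, if_neg (fun h => hjS h.1)]
    · rw [if_neg hjT, map_one, if_neg (fun h => hjT h.2)]
  have hff : fS.comp fT = fST :=
    continuous_extend_profinite_unique hι (hfSc.comp hfTc) hfSTc fun γ => by
      rw [MonoidHom.comp_apply, hfTι, hfSι, hfSTι, ← hρρ, MonoidHom.comp_apply]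
  apply le_antisymm
  · rintro x ⟨hxS, hxT⟩
    have : fST x = x := by
      rw [← hff, MonoidHom.comp_apply, hfTA x hxT, hfSA x hxS]
    rw [← this]
    exact hfSTmem x
  · exact le_inf
      (Subgroup.topologicalClosure_mono (Subgroup.map_mono
        (Subgroup.closure_mono (Set.image_mono Set.inter_subset_left))))
      (Subgroup.topologicalClosure_mono (Subgroup.map_mono
        (Subgroup.closure_mono (Set.image_mono Set.inter_subset_right))))

/-! ### Infinitude and commensurable terminality -/

omit [CompactSpace P] [TotallyDisconnectedSpace P] in
/-- `A_S` is infinite when `S ≠ ∅` (and `Σ` contains a prime): it contains the closure of `ι⟨b_s⟩`,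
infinite by `infinite_topologicalClosure_map_zpowers`. [cite: RibesZalesskii2010, Thm. 9.1.12] -/
theorem infinite_freeFactor {β : Type*} (b : FreeGroupBasis β Γ) (S : Set β) (hS : S.Nonempty)
    (hι : IsProSigmaCompletion Sigma ι) (hp : ∃ p ∈ Sigma, p.Prime) :
    Infinite ((Subgroup.closure (b '' S)).map ι).topologicalClosure := by
  obtain ⟨s, hs⟩ := hS
  haveI : IsFreeGroup Γ := b.isFreeGroup
  have hbs : b s ≠ 1 := fun h => by
    have := congrArg b.repr h
    rw [FreeGroupBasis.repr_apply_coe, map_one] at this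
    exact FreeGroup.of_ne_one _ this
  haveI := hι.infinite_topologicalClosure_map_zpowers hp hbs
  have hle : ((Subgroup.zpowers (b s)).map ι).topologicalClosure ≤
      ((Subgroup.closure (b '' S)).map ι).topologicalClosure :=
    Subgroup.topologicalClosure_mono (Subgroup.map_mono
      ((Subgroup.zpowers_le (g := b s)).mpr (Subgroup.subset_closure ⟨s, hs, rfl⟩)))
  exact Infinite.of_injective _ (Subgroup.inclusion_injective hle)

omit [TopologicalSpace P] [IsTopologicalGroup P] [CompactSpace P] [TotallyDisconnectedSpace P] in
/-- **An infinite malnormal subgroup is commensurably terminal**: if `A ∩ x A x⁻¹ = 1` for all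
`x ∉ A` and `A` is infinite, then `C_P(A) = A` (an `x ∈ C_P(A) ∖ A` would make the TRIVIAL subgroup
`A ∩ x A x⁻¹` of finite index in `A`). [cite: RibesZalesskii2010, Thm. 9.1.12] -/
theorem isCommensurablyTerminal_of_inf_conj_eq_bot {A : Subgroup P} [Infinite A]
    (h : ∀ x : P, x ∉ A → A ⊓ ConjAct.toConjAct x • A = ⊥) : AbsoluteAnabelian.IsCommensurablyTerminal A := by
  have hle : A ≤ Subgroup.Commensurable.commensurator A := by
    intro k hk
    rw [Subgroup.Commensurable.commensurator_mem_iff]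
    have hkA : ConjAct.toConjAct k • A = A := by
      ext z
      rw [Subgroup.mem_smul_pointwise_iff_exists]
      constructor
      · rintro ⟨s, hs, rfl⟩
        rw [ConjAct.toConjAct_smul]
        exact A.mul_mem (A.mul_mem hk hs) (A.inv_mem hk)
      · intro hz
        refine ⟨k⁻¹ * z * k, A.mul_mem (A.mul_mem (A.inv_mem hk) hz) hk, ?_⟩
        rw [ConjAct.toConjAct_smul]
        group
    rw [hkA]
  refine ⟨le_antisymm (fun x hx => ?_) hle⟩
  by_contra hxA
  have hbot := h x hxA
  have hcomm : Subgroup.Commensurable (ConjAct.toConjAct x • A) A :=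
    (Subgroup.Commensurable.commensurator_mem_iff A x).mp hx
  haveI hfi : ((ConjAct.toConjAct x • A).subgroupOf A).FiniteIndex := ⟨hcomm.1⟩
  have hne1 : ((ConjAct.toConjAct x • A).subgroupOf A) ≠ ⊥ := by
    intro hb
    have hidx := Subgroup.index_bot (G := A)
    rw [← hb] at hidx
    have := ((ConjAct.toConjAct x • A).subgroupOf A).index_ne_zero_of_finite
    rw [hidx] at this
    exact this Nat.card_eq_zero_of_infinite
  apply hne1
  rw [eq_bot_iff]
  intro z hz
  have hz' : (z : P) ∈ A ⊓ ConjAct.toConjAct x • A := ⟨z.2, hz⟩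
  rw [hbot, Subgroup.mem_bot] at hz'
  exact Subgroup.mem_bot.mpr (Subtype.ext hz')

/-- **`A_S` is commensurably terminal** (`S ≠ ∅`, `Σ` containing a prime): `C_P(A_S) = A_S` — the
[CombGC] Prop. 1.2 (ii) shape for a verticial subgroup that is the closure of a free factor.
[cite: RibesZalesskii2010, Thm. 9.1.12] -/
theorem freeFactor_isCommensurablyTerminal [T2Space P] {β : Type*} (b : FreeGroupBasis β Γ)
    (S : Set β) (hS : S.Nonempty) (hι : IsProSigmaCompletion Sigma ι) (hp : ∃ p ∈ Sigma, p.Prime) :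
    AbsoluteAnabelian.IsCommensurablyTerminal
      ((Subgroup.closure (b '' S)).map ι).topologicalClosure := by
  haveI := infinite_freeFactor b S hS hι hp
  exact isCommensurablyTerminal_of_inf_conj_eq_bot fun x hx => freeFactor_inf_conj_eq_bot b S hι hx

omit [TopologicalSpace P] [IsTopologicalGroup P] [CompactSpace P] [TotallyDisconnectedSpace P] in
/-- Commensurable terminality passes to conjugates: `C(γ A γ⁻¹) = γ C(A) γ⁻¹ = γ A γ⁻¹`.
[cite: RibesZalesskii2010, Thm. 9.1.12] -/
theorem commensurator_smul_eq_smul {A : Subgroup P}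
    (hA : AbsoluteAnabelian.IsCommensurablyTerminal A)
    (γ : ConjAct P) : Subgroup.Commensurable.commensurator (γ • A) = γ • A := by
  ext x
  rw [Subgroup.Commensurable.commensurator_mem_iff, Subgroup.mem_pointwise_smul_iff_inv_smul_mem,
    ← mul_smul, Subgroup.Commensurable.commensurable_conj γ⁻¹, ← mul_smul, ← mul_smul,
    inv_mul_cancel, one_smul]
  have hx : γ⁻¹ * (ConjAct.toConjAct x * γ) = ConjAct.toConjAct (γ⁻¹ • x) := by
    simp [ConjAct.smul_def, mul_assoc]
  rw [hx, ← Subgroup.Commensurable.commensurator_mem_iff, hA.commensurator_eq]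

/-! ### A non-openness criterion ([CombGC] Prop. 1.2 (i) shape) -/

omit [TotallyDisconnectedSpace P] in
/-- If an infinite closed subgroup `B ≤ A` meets `X` trivially, then `A ∩ X` is not open in `A`
(otherwise `B ∩ (A ∩ X) = 1` would be open in the infinite compact group `B`).
[cite: RibesZalesskii2010, Thm. 9.1.12] -/
theorem not_isOpen_inf_subgroupOf_of_inf_eq_bot {A X B : Subgroup P} (hBA : B ≤ A)
    (hB : IsClosed (B : Set P)) [Infinite B] (hBX : B ⊓ X = ⊥) :
    ¬ IsOpen (((A ⊓ X).subgroupOf A : Subgroup A) : Set A) := by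
  intro hopen
  have hcont : Continuous (Subgroup.inclusion hBA) := continuous_subtype_val.subtype_mk _
  have hpre : (Subgroup.inclusion hBA) ⁻¹' (((A ⊓ X).subgroupOf A : Subgroup A) : Set A) =
      ({1} : Set B) := by
    ext z
    simp only [Set.mem_preimage, SetLike.mem_coe, Subgroup.mem_subgroupOf, Set.mem_singleton_iff]
    change ((z : P) ∈ A ⊓ X) ↔ z = 1
    constructor
    · intro hz
      have : (z : P) ∈ B ⊓ X := ⟨z.2, hz.2⟩
      rw [hBX, Subgroup.mem_bot] at this
      exact Subtype.ext this
    · rintro rfl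
      exact ⟨hBA B.one_mem, X.one_mem⟩
  have h1 : IsOpen ({1} : Set B) := hpre ▸ hopen.preimage hcont
  haveI : DiscreteTopology B := discreteTopology_iff_isOpen_singleton_one.mpr h1
  haveI : CompactSpace B := isCompact_iff_compactSpace.mp hB.isCompact
  exact (‹Infinite B›).not_finite finite_of_compact_of_discrete

end Literature.AnabelianGeometry.SemiGraphs.SemiGraphOfAnabelioids.IsProSigmaCompletion
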